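import Mathlib
import HarnessLib
import HarnessLib.Audit
import Summits.ABC.Statement
import Literature.IUT.LogVolume.Corollary22PartIII
import Literature.IUT.LogVolume.Corollary22PartIAll
import Literature.IUT.LogVolume.Corollary23Chain
import Literature.IUT.LogVolume.Corollary23JInv
import HarnessLib.Audit.Status.Attr

/-!
Route: IUTThetaPilot

# Route IUTThetaPilot — abc from the theta-pilot Szpiro bound ([IUTchIV] Cor 2.2 (ii), uniform) plus
[GenEll] Thm 2.1 at Σ = {2}

X = ThetaPartII ("it suffices to show"), CONDITIONAL on [GenEll] Theorem 2.1 at Σ = {2}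
(MochizukiGenEll2010 — a refereed,
undisputed classical theorem not yet formalised; typed here as the support item GenEllTwo and
consumed by the deciding theorem).
ThetaPartII (the one crux, rank 2) is [IUTchIV] Corollary 2.2 (ii) in its uniform form — the
DIOPHANTINE OUTPUT of the theta-pilot /
q-pilot log-volume comparison ([IUTchIII] Cor. 3.12 ⟹ [IUTchIV] Thm 1.10): one constant H_unif such
that every compactly bounded
family K_V ⊆ P¹∖{0,1,∞} with 2 in its support and bounded j at 2 admits constants C_K, H_K and, for
each degree d and ε_d ∈ (0,1],
a finite exceptional set off which every point of degree ≤ d has a prime l ≥ 5 in the window (C1)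
with the theta-inequality (C2):
(1/6)·log q^∀ ≤ (1+ε_E)(log-diff + log-cond) + C_K. GenEllTwo (support) is [GenEll] Thm 2.1 (ii) ⟹
(i) at Σ = {2} for (P¹,{0,1,∞}):
Vojta on compactly bounded subsets whose support contains 2 gives uniform Vojta in every bounded
degree, hence abc. Both are typed
over the landed `Literature.IUT.LogVolume.Cor22.*` and `…GenEll.*` vocabulary (cell abc-iut,
campaign S); Parts (i) and (iii) of
Cor. 2.2, the low-range finiteness of Exc_d and the WLOG on j are already theorems.
Lean: `Summit.ABC.ABC.Theses.IUTThetaPilot.ThetaPartII`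

## Assembly
Pure logic over landed theorems: from ThetaPartII =: ⟨H_II, h⟩,
`Cor22.exists_corollary22_of_partI_partII Cor22.partI_holds h` (Parts (i) and (iii) are theorems)
gives H_unif with `Cor22.Corollary22 H_unif`; `Cor22.abcCompactlyBounded_two_of_corollary22`
with the WLOG `JInvWlog` (= `Cor22.JInvVacuous`, proved as `Cor22.jInvVacuous_holds`) gives
`GenEll.ABCCompactlyBounded {2}`; GenEllTwo gives `VojtaP1Deg d` for all d;
`GenEll.abc_of_vojtaP1Deg` and `ABC_iff` give `_root_.ABC` (deciding theorem `closes` in glue.lean,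
certified; all three binders consumed).

CONDITIONAL on Literature.NumberTheory.DiophantineGeometry.GenEll.GenEll_thm21 — this route is an explicit reduction to that named conjecture (D-0019: crux floor waived).

Rationale: WHY THIS LINE. This is the ledger object of the human-ruled cell abc-iut (D-0045/D-0053–D-0055,
D-0059(b)): formalise Mochizuki2012 end to end,
ending in a sorry-free `ABC` or a kernel-precise refutation of the [IUTchIII] Thm 3.11 ⟹ Cor. 3.12
inference — no side taken.
The route is cut at the one level where the tree already has FAITHFUL closed vocabulary: the
Diophantine output [IUTchIV] Cor. 2.2
(ii) (verified on kurims [IUTchIV] pp. 41–42; typed as `Cor22.PartII`, audited) — everything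
upstream (Hodge theaters, the
log-theta-lattice, Thm 3.11, Cor. 3.12, Thm 1.10 Steps (i)–(xi)) attaches BELOW ThetaPartII by glued
splits as the cell's
layers L1–L6/M/c312/S land the defined number −|log(Θ)| (today only the completion model of
`IndPacketModel` exists, so a
closed statement of Cor. 3.12 over the abstract `Setting` is junk-refutable through its free glue
fields — recorded dead end).
Imported areas: Arakelov-style height theory on M_ell (GenEll, Vojta), noncritical Belyi maps
(GenEllTwo), and the IUT
log-volume apparatus (ThetaPartII). Prior routes of this summit use no IUT lever; the negatives
index (2 entries: Belyi-degree
lower bound, quasi-log-derivative) is untouched by the crux and the supports. Why ONE crux: the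
printed chain has exactly one disputed
inference; every other link is classical (GenEll) or already a theorem in the tree, and a second
`crux` would be costume (C0/BC2).

RANKED CRUXES. #2 ThetaPartII (crux) — [IUTchIV] Corollary 2.2 (ii), uniform: ∃ H_unif ∀ compactly
bounded D with 2 ∈ support and j bounded at 2 (Cor22.Hypotheses D), Part (ii) holds (Cor22.PartII D
H_unif: C_K, H_K; per d, ε_d a finite Exc_d ⊆ points of degree ≤ d containing the j ∈ {0,1728}
points, log q^∀ ≤ H_unif·ε_d^{-3}·d^{4+ε_d} + H_K on Exc_d, and off Exc_d a prime l ≥ 5 with (C1)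
√(log q^∀) ≤ l ≤ 10δ√(log q^∀)·log(2δ·log q^∀) and (C2) (1/6)log q^∀ ≤ (1+ε_E)(log-diff + log-cond)
+ C_K). [difficulty: open-problem] (why it might fail: its only derivation is [IUTchIII] Thm 3.11 ⟹
Cor 3.12, disputed in print (ScholzeStix2018 §2.2: blur ≥ O(l²) voids it; LANA2026Report (9-1)
unproved); in-cell kernel finding questions Thm 1.10 Step (v) at d_mod > 1.) [Mochizuki2012,
MochizukiEtAl2022, DupuyHilado2020, DupuyHilado2025, ScholzeStix2018, LANA2026Report]
#9 GenEllTwo (support) — [GenEll] Theorem 2.1, (ii) ⟹ (i) at Σ = {2} for (P¹, {0,1,∞}): if Vojta's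
height inequality holds on D.toSet ∩ (degree ≤ d) for every d, ε and every compactly bounded D whose
support contains 2, then the uniform Vojta inequality holds for all points of degree ≤ d, every d ≥
1 (noncritical Belyi maps + Belyi1980). This is the route's CONDITIONAL_ON: a refereed theorem,
formalisation debt — its printed proof (pp. 13–14) passes through Galois covers Y → P¹ ramified over
{0,1,∞} and noncritical Belyi maps on general hyperbolic curves, vocabulary the tree does not have,
so no faithful P¹-only skeleton exists (checked: cusp-preserving self-maps of P¹ cannot move
cusp-adjacent points into K_V). [difficulty: XL] (why it might fail: as TYPED: BDLe/ht/logDiff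
conventions of GenEllProjLine must match [GenEll] Def 1.2 bounded-discrepancy classes and Ex 1.3
(ii); the tree's ∀Σ rendering GenEll_thm21 was found vacuous at non-prime Σ (A-Sd2-F1) — the
{2}-instance must survive the same audit.) [MochizukiGenEll2010, Belyi1980, ScholzeStix2018]
#9 JInvWlog (support) — the WLOG step opening the proof of [IUTchIV] Cor 2.2 / used in
`Cor22.abcCompactlyBounded_two_of_corollary22`: every compactly bounded family with 2 in its support
can be replaced by one satisfying `Cor22.Hypotheses` (j bounded at 2) for the purpose of Vojta on
degree ≤ d points — PROVED in the tree as `Literature.IUT.LogVolume.Cor22.jInvVacuous_holds`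
(Corollary23JInv.lean, p407661; olean pending at filing, hence carried by name as a support binder
of `closes`). [difficulty: provable-now] [Mochizuki2012, MochizukiGenEll2010]

TWO-LAYER PLAN. Registered birth skeleton (BC3, `Lines/birth.lean`): ThetaPartII ⇐ stub_cmLow (j ∈
{0,1728} ⇒ log q^∀ = 0: integral j, empty
support) + stub_theta (the uniform threshold form of Cor. 2.2 (ii) off the low range) + the LANDED
`Cor22.hasFinitelyManyPoints_logQForall_le_of_partI`
(Exc_d := the low range, finite by Northcott) — composition `ThetaPartII_of` kernel-checked, sorries
= stubs = 2. Next split of stub_theta: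
stub_theta ⇐ ThetaDisplay → ThetaDataSelection, once the point-level vocabulary lands (campaign S:
the display of
[IUTchIV] Thm 1.10 for a point P and an admissible prime l over `NFPoint`/`EllPoint`,
`Cor22.logQAvoid`, `GenEll.ImageModLContainsSL2`;
the numeric core `Cor22A.condition_C2` is already proved): ThetaDisplay = Thm 1.10's final display
per (P, l); ThetaDataSelection =
existence of admissible l in the (C1) window off a finite Exc_d ([IUTchIV] pp. 44–47, [GenEll] §3,
`GenEll_lemma37`/`GenEll_thm38`).
Below ThetaDisplay, once −|log(Θ)| is a DEFINED real number for a genuine tensor-packet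
`IndPacketModel` (campaigns S1/S2, D9′
table) and the D ↔ P dictionary exists: ThetaDisplay ⇐ Cor312AtDatum → HullVolumeAtDatum →
ThetaDisplay with glue = campaign-S
`theorem110` (proved: Steps (v)–(viii) squeeze `hull_le → Cor312 → CThetaAdmissible ∧ Display`) and
c312-8 `numbersOf_cor312_iff`;
Cor312AtDatum is where the [IUTchIII] Thm 3.11 ⟹ Cor 3.12 inference (campaign M / c312, the LANA
(9-1) compatibility) finally
becomes a typed item — for proof or for refutation.

KILL CRITERIA. A Theorems-side proof of ¬ThetaPartII (e.g. an explicit family violating (C2) with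
the printed ε_E, C_K-uniformity) closes the
route `refuted:ThetaPartII` — and is itself a cell deliverable (kernel-precise refutation downstream
of Cor. 3.12). ¬GenEllTwo as
typed (the conditional) forces a restatement of the GenEll vocabulary (pivot: re-type over the
repaired prime-Σ fact `GenEll.GenEll_thm21_primes` of S-d2 (p409822; the un-suffixed `GenEll_thm21`
is RETIRED, A-Sd2-F1)), not a
close. A proof of ABC by any other route moots it; a landed kernel refutation of the Thm 3.11 ⟹ Cor
3.12 inference (campaign M)
leaves ThetaPartII open but removes its only known derivation: the route then goes dormant with that
census.

NOT DECOMPOSED YET. Everything upstream of Cor. 2.2 (ii): Cor. 3.12 itself, Thm 1.10 Steps (i)–(xi),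
the prime-l selection, the (Ind1–3)
indeterminacy bookkeeping, the archimedean/2-adic local terms — deliberately NOT items at open:
their faithful typing needs
definitions the cell is landing this week (genuine tensor-packet model, D ↔ P dictionary, M-level
provenance of the glue fields
thetaRegionOf/qRegionOf). They enter as layer-2 children by `route edit --split` (Two-layer plan),
never as free-field structures.

CHEAPEST FALSIFIER. None cheap, and that is diagnostic: (C2) reads (1/6)log q^∀ ≤ (1+ε_E)(…) + C_K
with ε_E(d, log q^∀) ≥ 1 until log q^∀ ≳ 10^33,
so every tabulated elliptic curve satisfies it trivially (same reason the barrier entry expects no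
explicit witness against
Theorem B of MochizukiEtAl2022). The cheapest informative check is in-Lean: the junk/vacuity probe
of `Cor22.PartII` (run: C1
window non-empty needs log q^∀ ≥ 1, supplied by Exc_d; Hypotheses D inhabited via
GenEllProjLineExamples) — passed by audit A-S3.

NUMBERS. δ = 2^12·3^3·5·d; ε_E = (60δ)²·log(2δ·log q^∀)/√(log q^∀); Exc_d bound
H_unif·ε_d^{-3}·d^{4+ε_d} + H_K ([IUTchIV] Cor 2.2 (ii),
kurims pp. 41–42); Theorem B of MochizukiEtAl2022: |abc| ≤ 2^4·max{exp(1.7·10^30·ε^{-166/81}),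
rad^{3(1+ε)}} (barrier decl
`Literature.Barriers.ABC.IUTDisputedClaim`); Scholze–Stix: required blur ≥ O(l²) (ScholzeStix2018
§2.2 p. 10).

DEFINITION REQUESTS. (1) `IsThetaAdmissible (P : NFPoint) (l : ℕ)` — the hypotheses of [IUTchIV] Thm
1.10 on initial Θ-data read at a point of the
λ-line (l ≥ 5 prime, SL₂ ⊆ image mod l, l prime to the bad places and their local heights, V^bad_mod
≠ ∅) — topic
Literature/IUT/LogVolume (campaign S owns; staged as Corollary22Apex/PrimeChoice vocabulary). (2)
`thetaDisplay (P) (l)` — the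
final display of Thm 1.10 as a Prop over `Cor22.logQAvoid P {2,l}`, `NFPoint.logDiff/logCond`,
d_mod, d*_mod, η_prm. (3) the
genuine tensor-packet `IndPacketModel` instance and `negLogTheta (D) : ℝ` (campaign S1/S2, D9′
O-rows). Filed as `workitem add
--kind definition` after open, `--for` ThetaPartII.

Novelty: Searches (2026-08-25): lit search --hybrid "Mochizuki Corollary 3.12 explicit Szpiro compactly
bounded Vojta bounded degree" (8 generic
book hits, none IUT); lit vsearch "<uniform explicit Szpiro … theta-pilot … noncritical Belyi>" (8,
none IUT); lit search --source local
'"compactly bounded" Vojta' → [corpus:paper:doi-10-18926-mjou-33503 p.14] GenEll Thm 2.1; '"initial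
Θ-data" "log-volume"' →
[corpus:paper:anonnd-inter-universal-teichmuller-theory-iv-log-volume pp.41–42] Cor 2.2; lit galaxy
search "Corollary 3.12|theta-pilot|log-theta-lattice"
--star all (16 rows: [galaxy:pdf:-3565542054076490740] DupuyHilado 2004.13228,
[galaxy:pdf:-2250752962993196020] MochizukiEtAl2022, rest noise);
"Scholze-Stix|abc is still a conjecture|inter-universal Teichm" --star all (12 rows, same two pdf
hits); ledger idea list ABC (1 related
card: iut-cor312-conditional-bridge, closed known); Theses grep IUT|Mochizuki (barrier mentions
only); ledger negatives ABC (2, unrelated).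
Nearest prior art found: Mochizuki2012 [IUTchIV] Cor 2.2–2.3 + MochizukiGenEll2010 Thm 2.1 (the
printed chain itself); DupuyHilado2020
(arXiv:2004.13108: explicit/probabilistic Szpiro FROM Cor 3.12); card
ABC/ABC/iut-cor312-conditional-bridge (closed known: the same
chain as a conditional bridge, never typed).
Delta: no new mathematics is claimed — the delta is that the chain's Diophantine output and its
GenEll reduction are now CLOSED
Lean statements over audited vocabulary with a certified deciding theorem, so the dispu  [refs: 2004.13108, paper:doi-10-18926-mjou-33503, paper:anonnd-inter-universal-teichmuller-theory-iv-log-volume, MochizukiEtAl2022, Mochizuki2012, MochizukiGenEll2010, DupuyHilado2020]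

Barriers (technique_class: inter-universal-teichmuller-theory, multiradial-log-volume): - technique_class: inter-universal-teichmuller-theory, multiradial-log-volume
- Literature.Barriers.ABC.IUTDisputedClaim: it does not evade it; ThetaPartII sits INSIDE the class
(its only derivation is [IUTchIII] Thm 3.11 ⟹ Cor 3.12, the contested step; the barrier `blocks`
importing Thm 1.10/Cor 2.2 as established — here it is an OPEN CRUX, never a hypothesis-free fact).
The bet is the cell's: a kernel-level typing of the inference (LANA (9-1) compatibility;
Scholze–Stix O(l²) blur as a typed indeterminacy-volume statement) either discharges or refutes it.
GenEllTwo and the glue are OUTSIDE the class by the entry's own audit note (GenEll Thm 2.1,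
[IUTchIV] §§1–2 translation "standard", accepted by the dissent, ScholzeStix2018 §1.2).
- Literature.Barriers.ABC.EpsilonCannotBeDropped: not engaged — (C2) carries (1+ε_E) with ε_E → 0
only as log q^∀ → ∞ and the assembly produces `∀ ε > 0 ∃ C`, never an ε-free bound.
- Literature.Barriers.ABC.BakerMethodBounds: not in the class (no linear forms in logarithms
anywhere in the chain).
- Literature.Barriers.ABC.UniformABCDiscriminantSharp: GenEllTwo/VojtaP1Deg is uniform in bounded
degree d with the (1+ε)·log-diff term, the shape the sharpness entry permits; no discriminant
exponent below 1 is claimed.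
- Negatives index: 2 refuted statements (stmt-ABC-1205 DegBelyiLower, stmt-ABC-1689 separating
quasi-log-derivatives); neither crux mentions Belyi degree growth or quasi-log-derivatives — empty
intersection at filing.

sub-problem: ABC · status: draft · opened planner-abc-iut-plan-g5-0 2026-08-25T22:06:41Z · rev 3 · ledger route-ABC-IUTThetaPilot
GENERATED by the gate from the ledger (D-0016/17). Provers cite these decls: `theorem foo : Summit.ABC.ABC.Theses.IUTThetaPilot.<Decl> := …` in Summits/ABC/ABC/Theorems/<Name>.lean.
-/

namespace Summit.ABC.ABC.Theses.IUTThetaPilot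

open scoped BigOperators Topology Manifold Classical MeasureTheory ProbabilityTheory Matrix InnerProductSpace ComplexConjugate ContinuousMap
open Filter Set Function TopologicalSpace MeasureTheory

attribute [summit_statement] _root_.ABC

open Literature.Abc

/-- item stmt-ABC-19678 · crux · rank 2 · open · by planner
why it might fail: its only derivation is [IUTchIII] Thm 3.11 ⟹ Cor 3.12, disputed in print (ScholzeStix2018 §2.2: blur ≥ O(l²) voids it; LANA2026Report (9-1) unproved); in-cell kernel finding questions Thm 1.10 Step (v) at d_mod > 1.
sources: Mochizuki2012, MochizukiEtAl2022, DupuyHilado2020, DupuyHilado2025, ScholzeStix2018, LANA2026Report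
[crux] [IUTchIV] Corollary 2.2 (ii), uniform: ∃ H_unif ∀ compactly bounded D with 2 ∈ support and j
bounded at 2 (Cor22.Hypotheses D), Part (ii) holds (Cor22.PartII D H_unif: C_K, H_K; per d, ε_d a
finite Exc_d ⊆ points of degree ≤ d containing the j ∈ {0,1728} points, log q^∀ ≤
H_unif·ε_d^{-3}·d^{4+ε_d} + H_K on Exc_d, and off Exc_d a prime l ≥ 5 with (C1) √(log q^∀) ≤ l ≤
10δ√(log q^∀)·log(2δ·log q^∀) and (C2) (1/6)log q^∀ ≤ (1+ε_E)(log-diff + log-cond) + C_K).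
[difficulty: open-problem] -/
@[route_item "route-ABC-IUTThetaPilot", crux (experiment := "instrument: value law (crit-A CONCUR, G_∞^{1/3} bed-inert) · L4 KS d/dt (Baker-capped) · L5 weaker symmetry (all 5 readings worse)); CARDS FILED 2 + 1 …") (source := "director LADDER-ABC l.325, 2026-09-01")]
def ThetaPartII : Prop :=
  ∃ HII : ℝ, ∀ D : Literature.NumberTheory.DiophantineGeometry.GenEll.CBData, Literature.IUT.LogVolume.Cor22.Hypotheses D → Literature.IUT.LogVolume.Cor22.PartII D HII

/-- item stmt-ABC-19679 · support · rank 9 · closed · proved by Summit.ABC.ABC.Theorems.genEllTwo_holds (prover) · by planner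
why it might fail: as TYPED: BDLe/ht/logDiff conventions of GenEllProjLine must match [GenEll] Def 1.2 bounded-discrepancy classes and Ex 1.3 (ii); the tree's ∀Σ rendering GenEll_thm21 was found vacuous at non-prime Σ (A-Sd2-F1) — the {2}-instance must survive the same audit.
sources: MochizukiGenEll2010, Belyi1980, ScholzeStix2018
[support] [GenEll] Theorem 2.1, (ii) ⟹ (i) at Σ = {2} for (P¹, {0,1,∞}): if Vojta's height
inequality holds on D.toSet ∩ (degree ≤ d) for every d, ε and every compactly bounded D whose
support contains 2, then the uniform Vojta inequality holds for all points of degree ≤ d, every d ≥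
1 (noncritical Belyi maps + Belyi1980). This is the route's CONDITIONAL_ON: a refereed theorem,
formalisation debt — its printed proof (pp. 13–14) passes through Galois covers Y → P¹ ramified over
{0,1,∞} and noncritical Belyi maps on general hyperbolic curves, vocabulary the tree does not have,
so no faithful P¹-only skeleton exists (checked: cusp-preserving self-maps of P¹ cannot move
cusp-adjacent points into K_V). [difficulty: XL] -/
@[route_item "route-ABC-IUTThetaPilot", crux]
def GenEllTwo : Prop :=
  Literature.NumberTheory.DiophantineGeometry.GenEll.ABCCompactlyBounded {2} → ∀ d : ℕ, 0 < d → Literature.NumberTheory.DiophantineGeometry.GenEll.VojtaP1Deg d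

-- `GenEllTwo` holds: proved by `Summit.ABC.ABC.Theorems.genEllTwo_holds` (its module imports this route file, so no `_holds` link can be stated here).

/-- item stmt-ABC-19680 · support · rank 9 · closed · proved by Summit.ABC.ABC.Theorems.JInvWlog_proof @ 2224506e5561 (prover) · by planner
sources: Mochizuki2012, MochizukiGenEll2010
[support] the WLOG step opening the proof of [IUTchIV] Cor 2.2 / used in
`Cor22.abcCompactlyBounded_two_of_corollary22`: every compactly bounded family with 2 in its support
can be replaced by one satisfying `Cor22.Hypotheses` (j bounded at 2) for the purpose of Vojta on
degree ≤ d points — PROVED in the tree as `Literature.IUT.LogVolume.Cor22.jInvVacuous_holds`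
(Corollary23JInv.lean, p407661; olean pending at filing, hence carried by name as a support binder
of `closes`). [difficulty: provable-now] -/
@[route_item "route-ABC-IUTThetaPilot", crux]
def JInvWlog : Prop :=
  Literature.IUT.LogVolume.Cor22.JInvVacuous

-- `JInvWlog` holds: proved by `Summit.ABC.ABC.Theorems.JInvWlog_proof` @ 2224506e5561 (its module imports this route file, so no `_holds` link can be stated here).

/-- item stmt-ABC-19681 · assembly · rank 1 · closed · proved by Summit.ABC.ABC.Theorems.Assembly_proof @ 2224506e5561 (prover) · by planner
sources: Mochizuki2012, MochizukiGenEll2010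
[assembly] ThetaPartII → GenEllTwo → JInvWlog → ABC. -/
@[route_item "route-ABC-IUTThetaPilot"]
def Assembly : Prop :=
  ThetaPartII → GenEllTwo → JInvWlog → _root_.ABC

-- `Assembly` holds: proved by `Summit.ABC.ABC.Theorems.Assembly_proof` @ 2224506e5561 (its module imports this route file, so no `_holds` link can be stated here).

/-! D-0027 §2.1 — DECIDING THEOREM (planner-authored via `route open/edit --closes-file`; by planner-abc-iut-plan-g5-0 2026-08-25T22:06:41Z):
its hypotheses are this route's items and its conclusion the sub-problem Statement (glue_lint), and it elaborates with this file. -/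

@[closes "route-ABC-IUTThetaPilot"] theorem closes (hII : ThetaPartII) (hG : GenEllTwo) (hW : JInvWlog) : _root_.ABC := by
  obtain ⟨HII, h⟩ := hII
  obtain ⟨Hunif, h22⟩ :=
    Literature.IUT.LogVolume.Cor22.exists_corollary22_of_partI_partII
      Literature.IUT.LogVolume.Cor22.partI_holds h
  exact (ABC_iff).2
    (Literature.NumberTheory.DiophantineGeometry.GenEll.abc_of_vojtaP1Deg
      (hG (Literature.IUT.LogVolume.Cor22.abcCompactlyBounded_two_of_corollary22 h22 hW)))

end Summit.ABC.ABC.Theses.IUTThetaPilot
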